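import Summits.HodgeConjecture.HodgeConjecture.Theorems.MarkmanPartnerTransportPicardThreeK3SquaresOneCycleDegree
import Summits.HodgeConjecture.HodgeConjecture.Theorems.MarkmanPartnerTransportPicardThreeK3SquaresOneCycleOddPicard
import Summits.HodgeConjecture.HodgeConjecture.Theorems.MarkmanPartnerTransportPicardThreeK3SquaresRMSpreadOfCycleInduced
import Summits.HodgeConjecture.HodgeConjecture.Theorems.MarkmanPartnerTransportHilbertSquareOfRMSpread
import Summits.HodgeConjecture.HodgeConjecture.Theorems.MarkmanPartnerTransportPicardThreeK3SquaresSemiregularSeed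

/-!
# Route MarkmanPartnerTransport · «HECKE-SPREAD» (chapter ROUTE-P1AL): what ONE cycle-induced endomorphism with an
# irrational eigenvalue buys on a projective K3 surface of PICARD NUMBER ONE — generation of `End_Hdg T(S)`, the
# van Geemen–Schütt shape `IsCycleInducedRMK3 S 1 P`, HC⁴(S × S) and HC⁴ of every Hilbert square `S^{[2]}`

Planner p1 g39 (RULING r2 «HECKE-SPREAD», 2026-08-28T15:59:50Z; GO 16:03:15Z), prover seat hodge-nonav-19716-p2 (gen 7);
sequel to `…PicardThreeK3SquaresSepticRigidity` (step (a): at rank `21` the endomorphism field is totally real of degree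
`1`, `3` or `7`, prime when `≠ ℚ`). The K3-side consumer of a HECKE SOURCE at `ρ(S) = 1` (cells `(2,3)`, `(2,7)` of crux #5
through the partner `X = S^{[2]}`, `ρ(X) = 2`): a Hecke correspondence is an algebraic class on `S × S` by construction,
so it enters in the `he_cyc` shape below. Composition over tree theorems only:

* `natDegree_mul_mul_add_one_ne` — the arithmetic of rank `21`: `k · j · m + 1 ≠ 22` for all `j ≥ 2`, `m ≥ 3` as soon as
  `k ≠ 1` (`21 = 3 · 7`).
* (b) `transcendentalEndomorphismsGeneratedBy_of_picard_one` — **for a projective K3 surface `S` with `ρ(S) = 1`, every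
  rational type-preserving endomorphism `e` of `H²(S(ℂ); ℂ)` with an IRRATIONAL eigenvalue on a non-zero `(2,0)`-class
  GENERATES the rational Hodge endomorphisms of `T(S)`** (`TranscendentalEndomorphismsGeneratedBy S e`; markings only):
  the degree form `OneCycle.generatedBy_or_hasComplexMultiplication_of_eigenvalue_natDegree` (its arithmetic side
  condition holds at `ρ = 1` for every degree `k ≠ 1`, and `k = 1` would make the eigenvalue rational,
  `minpoly.natDegree_eq_one_iff`) with the CM branch killed by `OneCycle.not_hasComplexMultiplication_of_odd_picard`.
* `isCycleInducedRMK3_one_of_oneCycle` — if `e` is moreover cycle-induced (`IsCycleInducedTranscendentalEndomorphism`) and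
  annihilated on `T(S)` by `P`, then `IsCycleInducedRMK3 S 1 P` (the shape of the six van Geemen–Schütt facts); hence
  (`RMSpreadOfCycleInduced.nonempty_rmSpreadFamily_of_exists_algebraicClass`) an RM spread family through `S`.
* (c) `hodgeConjectureFor_square_of_cycleInduced_picard_one` — **HC⁴(S ⊗ S)** (`OneCycle.hodgeConjectureFor_square_of_oneCycle_of_odd_picard`
  at `ρ = 1`, on the `IsCycleInducedTranscendentalEndomorphism` binder; cf. `SepticRigidity.hodgeConjectureFor_square_of_oneCycle_picard_one`), and
  `hodgeConjectureFor_hilbertSquare_of_cycleInduced_picard_one` — **HC⁴(H) for every Hilbert square `H = S^{[2]}`**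
  (`PartnerLattice.hodgeConjectureFor_hilbertSquare_of_rmSpreadFamily` on the spread family of
  `nonempty_rmSpreadFamily_of_exists_algebraicClass`; mod Beauville's blow-up∕double-cover fact only);
  `hodgeConjectureFor_hilbertSquare_of_semiregularSeed_picard_one` — the Hilbert-square statement with the algebraicity
  of the inducing class supplied by a SEMIREGULAR SEED PACKAGE (`SemiregularSeed.mem_algebraicClasses_of_srSeed`, mod
  Bloch∕Buchweitz–Flenner; the seeded `S × S` statement is `SepticRigidity.hodgeConjectureFor_square_of_semiregularSeed_picard_one`).
  LANDED-BY-NAME note for (c): «every member `S′` of the RM spread family through `S`» is, in the tree's vocabulary,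
  `RMSpreadFamily.hodgeConjectureFor_square` for the marked member; the structure exposes no other member as a K3
  square, so nothing further is typable there.

CONDITIONAL only on the displayed facts {`Huybrechts_K3_marking_exists`; for Hilbert squares
`Beauville1983_hilbertSquare_blowupDiagonal_surjection`; for the seeded forms `BlochSemiregularSpread 4 2`} and on the
EXISTENCE of the endomorphism (a Hecke K3 with `ρ = 1`: open, targets H-T1∕H-T2); no definition, no sorry, no new named
fact; nothing here proves the crux or HC; rung F-H1 not moved. `--supports stmt-HodgeConjecture-19652`.

References: B. van Geemen, M. Schütt, Forum Math. Sigma 13 (2025) e2, §2.1, §4.8, Rem. 4.9; B. van Geemen, Michigan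
Math. J. 56 (2008) Lemma 3.2; D. Huybrechts, *Lectures on K3 Surfaces*, Ch. 3 §3.5; A. Beauville, J. Differential Geom.
18 (1983) §6; J. Ellenberg, Adv. Math. 162 (2001) §2.
-/

set_option linter.dupNamespace false

noncomputable section

namespace Summit.HodgeConjecture.HodgeConjecture.Theorems.MarkmanPartnerTransport.HeckeSpread

open Module CategoryTheory MonoidalCategory CartesianMonoidalCategory AlgebraicGeometry Polynomial
open Literature.AlgebraicGeometry Literature.AlgebraicGeometry.Motives Literature.AlgebraicGeometry.HodgeTheory
open Literature.AlgebraicGeometry.Surfaces Literature.AlgebraicGeometry.HilbertScheme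
open Literature.AlgebraicTopology.SingularHomology
open Summit.HodgeConjecture.HodgeConjecture.Theorems
open Summit.HodgeConjecture.HodgeConjecture.Theorems.MarkmanPartnerTransport
open Summit.HodgeConjecture.HodgeConjecture.Theorems.MarkmanPartnerTransport.OneCycle
open Summit.HodgeConjecture.HodgeConjecture.Theorems.MarkmanPartnerTransport.PartnerLattice
open Summit.HodgeConjecture.HodgeConjecture.Theorems.MarkmanPartnerTransport.SemiregularSeed

variable {S H : SchemeOver ℂ} {Ξ : (S ⊗ H).left.IdealSheafData}

/-- `Corr[hS ; γ, y] = fst_*(snd^* y ∪ γ)` on `H²(S(ℂ); ℂ)`, complex orientations (VERBATIM `…AlgebraicLocusSpread`).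
Local notation only. -/
local notation3 (prettyPrint := false) "Corr[" hS " ; " γ ", " y "]" =>
  complexGysin complexOrientationFamily (IsSmoothProjective.tensor_holds hS hS) hS
    (SemiCartesianMonoidalCategory.fst _ _) (rfl : 2 * 1 + 2 * 2 + 2 * 2 = 2 * 1 + 2 * (2 + 2))
    (cupProduct (rfl : 2 * 1 + 2 * 2 = 2 * 1 + 2 * 2)
      (complexBetti.map (SemiCartesianMonoidalCategory.snd _ _) (2 * 1) y) γ)

/-- `Res[f, s, k, A] = A|_{𝒳_s}` (VERBATIM `…OrphanSR`). Local notation only. -/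
local notation3 (prettyPrint := false) "Res[" f ", " s ", " k ", " A "]" =>
  complexBetti.map (Motives.fiberι f s) k A

/-- `SRSeed[S ; γ]`: a semiregular seed package for `γ ∈ H⁴((S ⊗ S)(ℂ); ℂ)` (VERBATIM `…PicardThreeK3SquaresSemiregularSeed`).
Local notation only. -/
local notation3 (prettyPrint := false) "SRSeed[" S " ; " γ "]" =>
  (∃ (X₀ : SchemeOver ℂ) (Z : Scheme.{0}) (i : Z ⟶ X₀.left) (x : complexBetti X₀ (2 * 2))
    (𝒳 B : SchemeOver ℂ) (f : 𝒳 ⟶ B) (s₀ t₁ : ComplexPoints B) (e₀ : X₀ ≅ fiberOver f s₀)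
    (e₁ : S ⊗ S ≅ fiberOver f t₁) (W : complexBetti 𝒳 (2 * 2)),
    IsClosedImmersion i ∧ IsRegularImmersionOfCodim i 2 ∧ AlgebraicGeometry.IsIntegral Z ∧
    (∀ z ∈ Set.range i.base, (2 : ℕ∞) ≤ Order.coheight z) ∧ IsBlochSemiregular i 4 2 ∧
    x ∈ classesSupportedOn X₀ (Set.range i.base) (2 * 2) ∧
    IsSmoothProjectiveFamily f 4 ∧ IsQuasiProjectiveOver 𝒳 ∧ IsQuasiProjectiveOver B ∧
    AlgebraicGeometry.Smooth B.hom ∧ ConnectedSpace (ComplexPoints B) ∧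
    (∀ s : ComplexPoints B, IsRationalClass (Res[f, s, 2 * 2, W]) ∧
      IsOfHodgeType 4 (fiberOver f s) (2 * 2) 2 2 (Res[f, s, 2 * 2, W])) ∧
    complexBetti.map e₀.hom (2 * 2) (Res[f, s₀, 2 * 2, W]) = x ∧
    complexBetti.map e₁.hom (2 * 2) (Res[f, t₁, 2 * 2, W]) - γ ∈ algebraicClasses (S ⊗ S) 2)

/-! ### The arithmetic of rank `21` -/

/-- **`k · j · m + 1 ≠ 22` for `k ≠ 1`, `j ≥ 2`, `m ≥ 3`** (`21 = 3 · 7` is not a product of three factors `≥ 2, ≥ 2, ≥ 3`,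
and `k = 0` gives `1 ≠ 22`): the side condition of the degree form of ONE CYCLE SUFFICES at `ρ(S) = 1`. [folklore] -/
theorem natDegree_mul_mul_add_one_ne {k j m : ℕ} (hk : k ≠ 1) (hj : 2 ≤ j) (hm : 3 ≤ m) : k * j * m + 1 ≠ 22 := by
  intro h
  have h21 : k * j * m = 21 := by omega
  rcases Nat.eq_zero_or_pos k with rfl | hk0
  · simp at h21
  have hk2 : 2 ≤ k := by omega
  have hkj : 4 ≤ k * j := by nlinarith
  have hm7 : m ≤ 5 := by nlinarith
  -- `m ∣ 21`, `3 ≤ m ≤ 5` ⟹ `m = 3`, then `k j = 7` with `k, j ≥ 2`: impossible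
  interval_cases m
  · have : k * j = 7 := by omega
    have hj3 : j ≤ 3 := by nlinarith
    interval_cases j <;> omega
  · omega
  · omega

/-! ### (b) Generation at `ρ(S) = 1` -/

/-- **(b) At Picard number one, an irrational eigenvalue generates.** For a projective K3 surface `S` with `ρ(S) = 1` and a
rational, type-preserving endomorphism `e` of `H²(S(ℂ); ℂ)` acting on a non-zero `(2,0)`-class by `ev ∉ ℚ`:
`TranscendentalEndomorphismsGeneratedBy S e` — every rational Hodge endomorphism of `T(S)` (killing `N¹`, image `⊥ N¹`)
is a rational polynomial in `e` on `T(S)`. The degree form of ONE CYCLE SUFFICES at `k = deg minpoly_ℚ(ev) ≠ 1`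
(`natDegree_mul_mul_add_one_ne`; `k = 1` is excluded by `minpoly.natDegree_eq_one_iff` and `ev ∉ ℚ`), the CM branch
being void at odd Picard number (`not_hasComplexMultiplication_of_odd_picard`). Markings only.
[cite: Vangeemen2008, Lemma 3.2] [cite: Huybrechts2016K3, Ch. 3 §3.5 and Rem. 3.3.14 (ii)] [cite: GeemenSchutt2023, §2.1] -/
theorem transcendentalEndomorphismsGeneratedBy_of_picard_one (hmark : Huybrechts_K3_marking_exists) (hS : IsK3Surface S)
    (hρ : Module.finrank ℂ ↥(algebraicClasses S 1) = 1)
    (e : complexBetti S (2 * 1) →ₗ[ℂ] complexBetti S (2 * 1))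
    (he_rat : ∀ y, IsRationalClass y → IsRationalClass (e y))
    (he_typ : ∀ (i j : ℕ) y, IsOfHodgeType 2 S (2 * 1) i j y → IsOfHodgeType 2 S (2 * 1) i j (e y))
    (he_ev : ∃ (σ₀ : complexBetti S (2 * 1)) (ev : ℂ), IsOfHodgeType 2 S (2 * 1) 2 0 σ₀ ∧ σ₀ ≠ 0 ∧
      e σ₀ = ev • σ₀ ∧ ∀ a : ℚ, (a : ℂ) ≠ ev) :
    TranscendentalEndomorphismsGeneratedBy S e := by
  obtain ⟨σ₀, ev, hσ₀, hσ₀ne, heσ₀, hirr⟩ := he_ev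
  have hk1 : (minpoly ℚ ev).natDegree ≠ 1 := by
    intro h1
    obtain ⟨a, ha⟩ := (minpoly.natDegree_eq_one_iff (A := ℚ) (x := ev)).1 h1
    exact hirr a (by rw [← ha]; rfl)
  have hk : ∀ j m : ℕ, 2 ≤ j → 3 ≤ m →
      (minpoly ℚ ev).natDegree * j * m + Module.finrank ℂ ↥(algebraicClasses S 1) ≠ 22 := by
    intro j m hj hm
    rw [hρ]
    exact natDegree_mul_mul_add_one_ne hk1 hj hm
  rcases generatedBy_or_hasComplexMultiplication_of_eigenvalue_natDegree hmark hS hk e he_rat he_typ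
      ⟨σ₀, ev, hσ₀, hσ₀ne, heσ₀, rfl⟩ with hgen | hCM
  · exact hgen
  · exact absurd hCM (not_hasComplexMultiplication_of_odd_picard hmark hS (by rw [hρ]; exact odd_one))

/-! ### The van Geemen–Schütt shape and the spread family at `ρ(S) = 1` -/

/-- **`IsCycleInducedRMK3 S 1 P` from one cycle-induced endomorphism with an irrational eigenvalue** (annihilated on `T(S)`
by `P`): `S` is K3 of Picard number `1`, has no CM (odd Picard number), and `e` is a cycle-induced transcendental
endomorphism generating `End_Hdg T(S)` (b). [cite: GeemenSchutt2023, §1, §2.1 and §4.8] -/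
theorem isCycleInducedRMK3_one_of_oneCycle (hmark : Huybrechts_K3_marking_exists) (hS : IsK3Surface S)
    (hρ : Module.finrank ℂ ↥(algebraicClasses S 1) = 1)
    (e : complexBetti S (2 * 1) →ₗ[ℂ] complexBetti S (2 * 1))
    (he : IsCycleInducedTranscendentalEndomorphism S hS.isSmoothProjective e)
    (he_ev : ∃ (σ₀ : complexBetti S (2 * 1)) (ev : ℂ), IsOfHodgeType 2 S (2 * 1) 2 0 σ₀ ∧ σ₀ ≠ 0 ∧
      e σ₀ = ev • σ₀ ∧ ∀ a : ℚ, (a : ℂ) ≠ ev)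
    {P : ℚ[X]} (hP : IsAnnihilatedOnTranscendentalBy S e P) : IsCycleInducedRMK3 S 1 P :=
  ⟨hS, hρ, not_hasComplexMultiplication_of_odd_picard hmark hS (by rw [hρ]; exact odd_one), e, he, hP,
    transcendentalEndomorphismsGeneratedBy_of_picard_one hmark hS hρ e he.1 he.2.1 he_ev⟩

/-- **An RM spread family through `S` at `ρ(S) = 1`** from one cycle-induced `e` (the constant family of
`RMSpreadOfCycleInduced.nonempty_rmSpreadFamily_of_exists_algebraicClass`; recorded with the generation clause (b) it
needs downstream). [cite: GeemenSchutt2023, §4.8] -/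
theorem nonempty_rmSpreadFamily_of_cycleInduced_picard_one (hmark : Huybrechts_K3_marking_exists) (hS : IsK3Surface S)
    (hρ : Module.finrank ℂ ↥(algebraicClasses S 1) = 1)
    (e : complexBetti S (2 * 1) →ₗ[ℂ] complexBetti S (2 * 1))
    (he : IsCycleInducedTranscendentalEndomorphism S hS.isSmoothProjective e)
    (he_ev : ∃ (σ₀ : complexBetti S (2 * 1)) (ev : ℂ), IsOfHodgeType 2 S (2 * 1) 2 0 σ₀ ∧ σ₀ ≠ 0 ∧
      e σ₀ = ev • σ₀ ∧ ∀ a : ℚ, (a : ℂ) ≠ ev) :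
    Nonempty (RMSpreadFamily S hS.isSmoothProjective e) ∧ TranscendentalEndomorphismsGeneratedBy S e :=
  ⟨nonempty_rmSpreadFamily_of_exists_algebraicClass hS.isSmoothProjective e he.2.2.2.2,
    transcendentalEndomorphismsGeneratedBy_of_picard_one hmark hS hρ e he.1 he.2.1 he_ev⟩

/-! ### (c) HC⁴ for `S × S` and for every Hilbert square `S^{[2]}` -/

/-- **(c₁) HC⁴(S ⊗ S) at `ρ(S) = 1` from one cycle-induced endomorphism with an irrational eigenvalue** (markings only;
`OneCycle.hodgeConjectureFor_square_of_oneCycle_of_odd_picard` at `ρ = 1` on the `IsCycleInducedTranscendentalEndomorphism` binder).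
[cite: GeemenSchutt2023, §4.8 and Rem. 4.9] [cite: Varesco2023, §2 (p. 8)] -/
theorem hodgeConjectureFor_square_of_cycleInduced_picard_one (hmark : Huybrechts_K3_marking_exists) (hS : IsK3Surface S)
    (hρ : Module.finrank ℂ ↥(algebraicClasses S 1) = 1)
    (e : complexBetti S (2 * 1) →ₗ[ℂ] complexBetti S (2 * 1))
    (he : IsCycleInducedTranscendentalEndomorphism S hS.isSmoothProjective e)
    (he_ev : ∃ (σ₀ : complexBetti S (2 * 1)) (ev : ℂ), IsOfHodgeType 2 S (2 * 1) 2 0 σ₀ ∧ σ₀ ≠ 0 ∧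
      e σ₀ = ev • σ₀ ∧ ∀ a : ℚ, (a : ℂ) ≠ ev) :
    HodgeConjectureFor 4 (S ⊗ S) :=
  hodgeConjectureFor_square_of_oneCycle_of_odd_picard hmark hS (by rw [hρ]; exact odd_one) complexOrientationFamily e
    he.1 he.2.1 he.2.2.2.2 he_ev

/-- **(c₂) HC⁴ for EVERY HILBERT SQUARE `H = S^{[2]}` of a projective K3 surface `S` with `ρ(S) = 1` carrying one
cycle-induced endomorphism with an irrational `(2,0)`-eigenvalue** — the fourfolds of cells `(2,3)` ∕ `(2,7)` of crux #5
(`ρ(H) = 2`, `E` cubic ∕ septic). Generation (b), the spread family of `nonempty_rmSpreadFamily_of_exists_algebraicClass`,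
and `PartnerLattice.hodgeConjectureFor_hilbertSquare_of_rmSpreadFamily` (blow up the diagonal, descend along the double
cover). Mod {markings, Beauville's blow-up∕double-cover fact}; credits nothing to HC beyond the displayed hypotheses.
[cite: Beauville1983, §6 (e)–(f), p. 766] [cite: GeemenSchutt2023, §4.8 and Rem. 4.9] [cite: VoisinHodgeII2003, §7.3.2] -/
theorem hodgeConjectureFor_hilbertSquare_of_cycleInduced_picard_one
    (hBea : Beauville1983_hilbertSquare_blowupDiagonal_surjection) (hmark : Huybrechts_K3_marking_exists)
    (hS : IsK3Surface S) (hρ : Module.finrank ℂ ↥(algebraicClasses S 1) = 1)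
    (hHilb : IsHilbertSchemeOfPoints 2 S H Ξ) (hH : IsSmoothProjective 4 H)
    (e : complexBetti S (2 * 1) →ₗ[ℂ] complexBetti S (2 * 1))
    (he : IsCycleInducedTranscendentalEndomorphism S hS.isSmoothProjective e)
    (he_ev : ∃ (σ₀ : complexBetti S (2 * 1)) (ev : ℂ), IsOfHodgeType 2 S (2 * 1) 2 0 σ₀ ∧ σ₀ ≠ 0 ∧
      e σ₀ = ev • σ₀ ∧ ∀ a : ℚ, (a : ℂ) ≠ ev) :
    HodgeConjectureFor 4 H := by
  obtain ⟨⟨F⟩, hgen⟩ := nonempty_rmSpreadFamily_of_cycleInduced_picard_one hmark hS hρ e he he_ev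
  exact hodgeConjectureFor_hilbertSquare_of_rmSpreadFamily hBea hS.isSmoothProjective hHilb hH he.1 he.2.2.1 hgen F

/-! ### The seeded forms (semiregular seed package in place of «`γ` algebraic») -/

/-- **(c₂, seeded)** HC⁴ for every Hilbert square `H = S^{[2]}` at `ρ(S) = 1` from `e = [γ]_*` rational, type-preserving,
killing `N¹(S)` with image `⊥ N¹(S)`, an irrational `(2,0)`-eigenvalue and a semiregular seed package for `γ`.
Mod {markings, Beauville, Bloch∕BF}. [cite: BuchweitzFlenner2003, Thm. 5.2] [cite: Beauville1983, §6 (e)–(f), p. 766] -/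
theorem hodgeConjectureFor_hilbertSquare_of_semiregularSeed_picard_one
    (hBea : Beauville1983_hilbertSquare_blowupDiagonal_surjection) (hmark : Huybrechts_K3_marking_exists)
    (hBl : BlochSemiregularSpread 4 2) (hS : IsK3Surface S) (hρ : Module.finrank ℂ ↥(algebraicClasses S 1) = 1)
    (hHilb : IsHilbertSchemeOfPoints 2 S H Ξ) (hH : IsSmoothProjective 4 H)
    (e : complexBetti S (2 * 1) →ₗ[ℂ] complexBetti S (2 * 1))
    (he_rat : ∀ y, IsRationalClass y → IsRationalClass (e y))
    (he_typ : ∀ (i j : ℕ) y, IsOfHodgeType 2 S (2 * 1) i j y → IsOfHodgeType 2 S (2 * 1) i j (e y))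
    (he_N : ∀ d ∈ algebraicClasses S 1, e d = 0)
    (he_perp : ∀ y : complexBetti S (2 * 1), ∀ d ∈ algebraicClasses S 1,
      cupProduct (rfl : 2 * 1 + 2 * 1 = 2 * 2) (e y) d = 0)
    {γ : complexBetti (S ⊗ S) (2 * 2)} (he_γ : ∀ y : complexBetti S (2 * 1), e y = Corr[hS.isSmoothProjective ; γ, y])
    (hseed : SRSeed[S ; γ])
    (he_ev : ∃ (σ₀ : complexBetti S (2 * 1)) (ev : ℂ), IsOfHodgeType 2 S (2 * 1) 2 0 σ₀ ∧ σ₀ ≠ 0 ∧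
      e σ₀ = ev • σ₀ ∧ ∀ a : ℚ, (a : ℂ) ≠ ev) :
    HodgeConjectureFor 4 H :=
  hodgeConjectureFor_hilbertSquare_of_cycleInduced_picard_one hBea hmark hS hρ hHilb hH e
    (isCycleInducedTranscendentalEndomorphism_of_semiregularSeed hBl hS.isSmoothProjective e he_rat he_typ he_N he_perp
      he_γ hseed) he_ev

end Summit.HodgeConjecture.HodgeConjecture.Theorems.MarkmanPartnerTransport.HeckeSpread

end
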